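import Literature.NumberTheory.LFunctions.Zhang2022.DetectorMainTermForm

/-!
# Zhang (2022), programme F-S3 (cell landau-siegel, family B-det): SIGN-ADMISSIBLE shift triples —
# the hypothesis shape of Lemma 2.3 as a predicate on the recipe data `b`

Y. Zhang, *Discrete mean estimates and the Landau–Siegel zero*, arXiv:2211.02515v1 [Zhang2022LandauSiegel] —
an unrefereed manuscript under adjudication. **WHAT THIS IS NOT: not a claim about Theorems 1–2 of
arXiv:2211.02515, about Landau–Siegel zeros, or about Parity; nothing here asserts any claim of the manuscript.**
«The programme SEARCHES and TYPES; no claim about Landau–Siegel zeros, Theorems 1–2 of arXiv:2211.02515 or a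
repaired Margin232 until a kernel theorem says so.»

The detector weight `𝔠*(ρ,ψ) = −iM(ρ+β₁)M(ρ+β₂)M(ρ+β₃)/M′(ρ) = M(ρ+β₂)M(ρ+β₃)·[M(ρ+β₁)/(iM′(ρ))]` is `≥ 0` at
every sampled zero (Lemma 2.3) and the PROOF (p. 12) uses exactly two facts about the shift multiples
`b = (1⁻, 2⁺, 3⁻)` (`β_j = ib_jα`, (2.13)) relative to the `α`-fence of product zeros above `ρ` (Prop 2.2 (iii)):
(a) `M(ρ+iv,ψ) ≠ 0` for `|β₂| ≤ v ≤ |β₃|` — the two shifts `β₂, β₃` sit inside ONE product-zero-free gap, so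
`M(ρ+β₂)M(ρ+β₃) > 0` by the intermediate value theorem, whichever of `L(s,ψ)`, `L(s,ψχ)` the fence zeros belong
to; (b) `M(ρ+β₁)/M(ρ+iv) > 0` for `0 < v ≤ |β₁|` — the shift `β₁` lies BELOW the first fence zero, so the limit
`M(ρ+β₁)/(iM′(ρ)) = lim_{v→0⁺} vM(ρ+β₁)/M(ρ+iv) ≥ 0` pairs it with the `1/M′` factor. `Det.SignAdmissible b` is
that shape for a sorted, pairwise distinct real triple at the main values (integers read as the one-sided limits
the printed `c′α𝓛`-corrections select, e.g. `(1,2,3) = (1⁻,2⁺,3⁻)`): `0 < b₀ < b₁ < b₂`, `b₀ ≤ 1`, and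
`k ≤ b₁`, `b₂ ≤ k+1` for some `k ∈ ℕ`. It is the «`K`» conjunct the cell's §E slice S-E-p6-1 and the registry row
E-010 quantify over (the slot there is `∀ b, SignAdmissible b → InShiftBox b → Det.FormDetPSD (Det.shiftRecipe b)`,
a theorem at `b = (1,2,3)` by `Det.formDetPSD_shiftRecipe_std`, NOT asserted here for other `b`); PROVED instances:
`(1,2,3)`, `(1,3,4)`, `(½,2,3)`, `(3/10,3/5,4/5)` admissible; `(1,2,4)`, `(3/2,5/2,7/2)`, `(2,3,4)` not.

DECLARED NARROWING relative to the repair cell's reading of the proof (LEVERS L8 (i)–(iv)): pattern (iii)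
«straddling pairs» (product `< 0` of known sign — admissible only up to a global factor `−1`, i.e. the recipe `−W`)
and pattern (iv) «repeated shifts» (`M(ρ+β)² ≥ 0` — a double-pole residue, NOT the simple-pole operator shape of
`Det.shiftRecipe`, whose weights divide by `Π(b_i − b_j)`) are EXCLUDED here; so is any triple with two or three
sub-gap shifts other than through `k = 0` (all three in the first gap: `(b₁, b₂)` is then the pair). The Part-III
contour cap `max b_j < 5` (census III-14.P) is a separate conjunct (`InShiftBox`), not part of the sign pattern.
Equivalent lattice-symbol reading used by the cell's numerics (`Π_i(b_i − k) ≤ 0` for every integer `k ≥ 1`) is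
recorded in the docstrings, not proved here.
-/

noncomputable section

open Real

namespace Literature.NumberTheory.LFunctions.Zhang2022

namespace Det

/-- **Sign-admissible shift triple** (the hypothesis shape of the proof of Lemma 2.3 at the main values):
sorted and pairwise distinct, `0 < b₀ < b₁ < b₂`; ONE sub-first-gap shift `b₀ ≤ 1` (paired with `1/(iM′(ρ))`);
the other two inside ONE gap of the `α`-fence, `k ≤ b₁ < b₂ ≤ k + 1` for some `k ∈ ℕ` (so `M(ρ+β₁)M(ρ+β₂) > 0`).
Printed: `(1,2,3)` read as `(1⁻, 2⁺, 3⁻)` with `k = 2`. Lattice-symbol form (cell numerics): `Π_i(b_i − k) ≤ 0` for all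
integers `k ≥ 1`. [cite: Zhang2022LandauSiegel, §2 Lemma 2.3 and its proof p. 12, (2.13)] -/
def SignAdmissible (b : Fin 3 → ℝ) : Prop :=
  0 < b 0 ∧ b 0 < b 1 ∧ b 1 < b 2 ∧ b 0 ≤ 1 ∧ ∃ k : ℕ, (k : ℝ) ≤ b 1 ∧ b 2 ≤ k + 1

/-- **The Part-III shift box** `0 < b_j < 5` for every channel (the contour `|s| = 5α` of Part III caps the shift
multiples; census III-14.P) — a separate conjunct, not a sign condition. [cite: Zhang2022LandauSiegel, §2 (2.13); §14 (14.2)] -/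
def InShiftBox (b : Fin 3 → ℝ) : Prop := ∀ j : Fin 3, 0 < b j ∧ b j < 5

variable {b : Fin 3 → ℝ}

/-- A sign-admissible triple is pairwise distinct (so the recipe weights `Det.shiftW`, which divide by
`Π_{i≠j}(b_i − b_j)`, have non-zero denominators). [cite: Zhang2022LandauSiegel, §2 Lemma 2.3, (2.13)] -/
theorem SignAdmissible.injective (h : SignAdmissible b) : Function.Injective b := by
  obtain ⟨_, h01, h12, -, -⟩ := h
  intro i j hij
  fin_cases i <;> fin_cases j <;> simp_all <;> linarith

/-- All entries of a sign-admissible triple are positive. [cite: Zhang2022LandauSiegel, §2 Lemma 2.3, (2.13)] -/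
theorem SignAdmissible.pos (h : SignAdmissible b) (j : Fin 3) : 0 < b j := by
  obtain ⟨h0, h01, h12, -, -⟩ := h
  fin_cases j
  · exact h0
  · exact h0.trans h01
  · exact (h0.trans h01).trans h12

/-- The Vandermonde denominators `v_j(b) = Π_{i≠j}(b_i − b_j)` of `Det.shiftW` are non-zero on sign-admissible
triples. [cite: Zhang2022LandauSiegel, proof of Prop 7.1, (7.19)–(7.20)] -/
theorem SignAdmissible.shiftVdm_ne_zero (h : SignAdmissible b) (j : Fin 3) : shiftVdm b j ≠ 0 := by
  obtain ⟨_, h01, h12, -, -⟩ := h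
  have h02 : b 0 < b 2 := h01.trans h12
  fin_cases j
  · simp only [shiftVdm, Fin.zero_eta, Matrix.cons_val_zero]
    exact mul_ne_zero (sub_ne_zero.2 h01.ne') (sub_ne_zero.2 h02.ne')
  · simp only [shiftVdm, Fin.mk_one, Matrix.cons_val_one]
    exact mul_ne_zero (sub_ne_zero.2 h12.ne') (sub_ne_zero.2 h01.ne)
  · simp only [shiftVdm, Fin.reduceFinMk, Matrix.cons_val_two, Matrix.tail_cons, Matrix.head_cons]
    exact mul_ne_zero (sub_ne_zero.2 h02.ne) (sub_ne_zero.2 h12.ne)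

/-! ### Instances (the printed triple and the cell's probes) -/

/-- **The printed triple `(1,2,3)` is sign-admissible** (`k = 2`: the pair `(2⁺,3⁻)` in the gap `(2α,3α)`).
[cite: Zhang2022LandauSiegel, §2 Lemma 2.3, (2.13)] -/
theorem signAdmissible_std : SignAdmissible ![1, 2, 3] := by
  refine ⟨by simp, by norm_num [Matrix.cons_val_zero, Matrix.cons_val_one, Matrix.cons_val_two, Matrix.head_cons, Matrix.tail_cons], by norm_num [Matrix.cons_val_zero, Matrix.cons_val_one, Matrix.cons_val_two, Matrix.head_cons, Matrix.tail_cons], by simp, 2, by norm_num [Matrix.cons_val_zero, Matrix.cons_val_one, Matrix.cons_val_two, Matrix.head_cons, Matrix.tail_cons], by norm_num [Matrix.cons_val_zero, Matrix.cons_val_one, Matrix.cons_val_two, Matrix.head_cons, Matrix.tail_cons]⟩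

/-- `(1,3,4)` is sign-admissible (`k = 3`). [cite: Zhang2022LandauSiegel, §2 Lemma 2.3, (2.13)] -/
theorem signAdmissible_134 : SignAdmissible ![1, 3, 4] := by
  refine ⟨by simp, by norm_num [Matrix.cons_val_zero, Matrix.cons_val_one, Matrix.cons_val_two, Matrix.head_cons, Matrix.tail_cons], by norm_num [Matrix.cons_val_zero, Matrix.cons_val_one, Matrix.cons_val_two, Matrix.head_cons, Matrix.tail_cons], by simp, 3, by norm_num [Matrix.cons_val_zero, Matrix.cons_val_one, Matrix.cons_val_two, Matrix.head_cons, Matrix.tail_cons], by norm_num [Matrix.cons_val_zero, Matrix.cons_val_one, Matrix.cons_val_two, Matrix.head_cons, Matrix.tail_cons]⟩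

/-- `(½,2,3)` is sign-admissible (mid-gap first shift; `k = 2`). [cite: Zhang2022LandauSiegel, §2 Lemma 2.3, (2.13)] -/
theorem signAdmissible_half23 : SignAdmissible ![1 / 2, 2, 3] := by
  refine ⟨by simp, by norm_num [Matrix.cons_val_zero, Matrix.cons_val_one, Matrix.cons_val_two, Matrix.head_cons, Matrix.tail_cons], by norm_num [Matrix.cons_val_zero, Matrix.cons_val_one, Matrix.cons_val_two, Matrix.head_cons, Matrix.tail_cons], by norm_num [Matrix.cons_val_zero, Matrix.cons_val_one, Matrix.cons_val_two, Matrix.head_cons, Matrix.tail_cons], 2, by norm_num [Matrix.cons_val_zero, Matrix.cons_val_one, Matrix.cons_val_two, Matrix.head_cons, Matrix.tail_cons],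
    by norm_num [Matrix.cons_val_zero, Matrix.cons_val_one, Matrix.cons_val_two, Matrix.head_cons, Matrix.tail_cons]⟩

/-- `(3/10, 3/5, 4/5)` is sign-admissible with `k = 0` (all three shifts in the first gap: one paired with `1/M′`, the
other two a pair). [cite: Zhang2022LandauSiegel, §2 Lemma 2.3, (2.13)] -/
theorem signAdmissible_firstGap : SignAdmissible ![3 / 10, 3 / 5, 4 / 5] := by
  refine ⟨by norm_num [Matrix.cons_val_zero, Matrix.cons_val_one, Matrix.cons_val_two, Matrix.head_cons, Matrix.tail_cons], by norm_num [Matrix.cons_val_zero, Matrix.cons_val_one, Matrix.cons_val_two, Matrix.head_cons, Matrix.tail_cons], by norm_num [Matrix.cons_val_zero, Matrix.cons_val_one, Matrix.cons_val_two, Matrix.head_cons, Matrix.tail_cons], by norm_num [Matrix.cons_val_zero, Matrix.cons_val_one, Matrix.cons_val_two, Matrix.head_cons, Matrix.tail_cons], 0, by norm_num [Matrix.cons_val_zero, Matrix.cons_val_one, Matrix.cons_val_two, Matrix.head_cons, Matrix.tail_cons],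
    by norm_num [Matrix.cons_val_zero, Matrix.cons_val_one, Matrix.cons_val_two, Matrix.head_cons, Matrix.tail_cons]⟩

/-- `(1,2,4)` is NOT sign-admissible (`2` and `4` are not in one unit gap). [cite: Zhang2022LandauSiegel, §2 Lemma 2.3, (2.13)] -/
theorem not_signAdmissible_124 : ¬ SignAdmissible ![1, 2, 4] := by
  rintro ⟨-, -, -, -, k, hk1, hk2⟩
  simp only [Matrix.cons_val_zero, Matrix.cons_val_one, Matrix.cons_val_two, Matrix.head_cons, Matrix.tail_cons] at hk1 hk2
  linarith

/-- `(3/2, 5/2, 7/2)` is NOT sign-admissible (no sub-first-gap shift). [cite: Zhang2022LandauSiegel, §2 Lemma 2.3, (2.13)] -/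
theorem not_signAdmissible_threeHalves : ¬ SignAdmissible ![3 / 2, 5 / 2, 7 / 2] := by
  rintro ⟨-, -, -, h1, -⟩
  norm_num [Matrix.cons_val_zero, Matrix.cons_val_one, Matrix.cons_val_two, Matrix.head_cons, Matrix.tail_cons] at h1

/-- `(2,3,4)` is NOT sign-admissible (no sub-first-gap shift). [cite: Zhang2022LandauSiegel, §2 Lemma 2.3, (2.13)] -/
theorem not_signAdmissible_234 : ¬ SignAdmissible ![2, 3, 4] := by
  rintro ⟨-, -, -, h1, -⟩
  norm_num [Matrix.cons_val_zero, Matrix.cons_val_one, Matrix.cons_val_two, Matrix.head_cons, Matrix.tail_cons] at h1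

/-- The printed triple lies in the Part-III box. [cite: Zhang2022LandauSiegel, §2 (2.13); §14 (14.2)] -/
theorem inShiftBox_std : InShiftBox ![1, 2, 3] := by
  intro j
  fin_cases j <;> norm_num [Matrix.cons_val_zero, Matrix.cons_val_one, Matrix.cons_val_two, Matrix.head_cons, Matrix.tail_cons]

/-! ### The lattice-symbol reading (the cell numerics' admissibility test) is EQUIVALENT to `SignAdmissible` -/

/-- **The lattice symbol test of the cell's numerics:** `Π_i (b_i − k) ≤ 0` for every integer `k ≥ 1` (the sign
pattern of the bulk symbol `η(η+b₀)(η+b₁)(η+b₂)` on the fence; how lineages A/B and the referee ENUMERATE the admissible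
cells of the design maps: 18 triples at step ½, 144 at step ¼ in `(0,5)`). [cite: Zhang2022LandauSiegel, §2 Lemma 2.3, (2.13)] -/
def LatticeSymbolNonpos (b : Fin 3 → ℝ) : Prop :=
  ∀ k : ℕ, 1 ≤ k → (b 0 - k) * (b 1 - k) * (b 2 - k) ≤ 0

/-- **`SignAdmissible` ⇒ the lattice symbol is `≤ 0` at every integer `k ≥ 1`**: `b₀ − k ≤ 0`, and `(b₁−k)(b₂−k) < 0`
would put the integer `k` strictly inside the pair's gap `[k₀, k₀+1]`. [cite: Zhang2022LandauSiegel, §2 Lemma 2.3, (2.13)] -/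
theorem SignAdmissible.latticeSymbolNonpos (h : SignAdmissible b) : LatticeSymbolNonpos b := by
  obtain ⟨h0, h01, h12, h0le, k₀, hk₀1, hk₀2⟩ := h
  intro k hk
  have hk1 : (1 : ℝ) ≤ k := by exact_mod_cast hk
  have hb0 : b 0 - k ≤ 0 := by linarith
  by_cases hprod : 0 ≤ (b 1 - k) * (b 2 - k)
  · have : (b 0 - k) * (b 1 - k) * (b 2 - k) = (b 0 - k) * ((b 1 - k) * (b 2 - k)) := by ring
    rw [this]
    exact mul_nonpos_of_nonpos_of_nonneg hb0 hprod
  · -- `(b₁ − k)(b₂ − k) < 0` forces `b₁ < k < b₂`, i.e. `k₀ < k < k₀ + 1` in `ℕ`: impossible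
    exfalso
    push Not at hprod
    have hlt1 : b 1 < k := by
      by_contra hle
      push Not at hle
      have : 0 ≤ (b 1 - k) * (b 2 - k) := mul_nonneg (by linarith) (by linarith)
      linarith
    have hlt2 : (k : ℝ) < b 2 := by
      by_contra hle
      push Not at hle
      have : 0 ≤ (b 1 - k) * (b 2 - k) := mul_nonneg_of_nonpos_of_nonpos (by linarith) (by linarith)
      linarith
    have h1 : (k₀ : ℝ) < k := lt_of_le_of_lt hk₀1 hlt1
    have h2 : (k : ℝ) < k₀ + 1 := lt_of_lt_of_le hlt2 hk₀2
    have h1' : k₀ < k := by exact_mod_cast h1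
    have h2' : k < k₀ + 1 := by exact_mod_cast h2
    omega

/-- **Conversely, a sorted positive triple whose lattice symbol is `≤ 0` at every integer `k ≥ 1` is `SignAdmissible`**
(`k = 1` forces `b₀ ≤ 1`; with `k₀ = ⌊b₁⌋`, `b₂ > k₀ + 1` would make the symbol positive at `k₀ + 1`). So the design
maps' symbol-enumerated «admissible» cells are exactly the `SignAdmissible` triples. [cite: Zhang2022LandauSiegel, §2 Lemma 2.3, (2.13)] -/
theorem signAdmissible_of_latticeSymbolNonpos (h0 : 0 < b 0) (h01 : b 0 < b 1) (h12 : b 1 < b 2)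
    (hsym : LatticeSymbolNonpos b) : SignAdmissible b := by
  have hb1 : 0 < b 1 := h0.trans h01
  refine ⟨h0, h01, h12, ?_, ⌊b 1⌋₊, Nat.floor_le hb1.le, ?_⟩
  · -- `k = 1`
    by_contra hgt
    push Not at hgt
    have h := hsym 1 le_rfl
    push_cast at h
    have : 0 < (b 0 - 1) * (b 1 - 1) * (b 2 - 1) :=
      mul_pos (mul_pos (by linarith) (by linarith)) (by linarith)
    linarith
  · -- `k = ⌊b₁⌋ + 1`
    by_contra hgt
    push Not at hgt
    have hfl : b 1 < (⌊b 1⌋₊ : ℝ) + 1 := Nat.lt_floor_add_one (b 1)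
    have h := hsym (⌊b 1⌋₊ + 1) (by omega)
    push_cast at h
    have : 0 < (b 0 - (⌊b 1⌋₊ + 1)) * (b 1 - (⌊b 1⌋₊ + 1)) * (b 2 - (⌊b 1⌋₊ + 1)) :=
      mul_pos (mul_pos_of_neg_of_neg (by linarith) (by linarith)) (by linarith)
    linarith

/-- **Equivalence of the two admissibility readings.** [cite: Zhang2022LandauSiegel, §2 Lemma 2.3, (2.13)] -/
theorem signAdmissible_iff_latticeSymbolNonpos :
    SignAdmissible b ↔ 0 < b 0 ∧ b 0 < b 1 ∧ b 1 < b 2 ∧ LatticeSymbolNonpos b :=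
  ⟨fun h => ⟨h.1, h.2.1, h.2.2.1, h.latticeSymbolNonpos⟩,
    fun h => signAdmissible_of_latticeSymbolNonpos h.1 h.2.1 h.2.2.1 h.2.2.2⟩

end Det

end Literature.NumberTheory.LFunctions.Zhang2022
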